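import Summits.CriticalPhenomena.CardyFormulaZ2.Theorems.CardyIKTransportIKLinearTransportTwoSidedKernelLaw
import Summits.CriticalPhenomena.CardyFormulaZ2.Theorems.CardyIKTransportIKLinearTransportTwoCutGauge
import Summits.CriticalPhenomena.CardyFormulaZ2.Theorems.CardyIKTransportIKLinearTransportRectIdentity
import Summits.CriticalPhenomena.CardyFormulaZ2.Theorems.CardyIKTransportIKLinearTransportTwoCutComb2

/-!
# Stub `stub_TwoSidedCutMarkovKernel` (K₂) — THE TWO-SIDED CUT-MARKOV VERSION (final assembly)

`--supports stmt-CriticalPhenomena-5076`; proves the registered stub `stub_TwoSidedCutMarkovKernel` of the line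
`pinned-diagram-exchange` (crux `CardyIKTransport.IKLinearTransport`) BY NAME, sorry-free, from the landed parts:
the two-cut combinatorics `stub_TwoCutComb` (W1), the rectangle property of the atom pull-back in the cut-adapted gauge
`stub_TwoCutGauge` (W2), the abstract rectangle identity `stub_RectIdentity` (W3), the assembly of the factorisation
identity `tc_factorisation_of` and the kernel `tcK` with its `CutMarkovKernel` fields and `ReadsEnv`
(`tc_cutMarkovKernel_of`, lead c2). With the landed transfer `cutMarkov_local_approx_of_twoSided` (p125069) this closes (Loc),
hence `stub_CoalescingRowKernel`, `stub_RowCFTP`, `stub_PinnedSampler` and THE BET `stub_PinnedExchange` of the line: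
Manolescu's exchange kernel (arXiv:2502.08394, Fact 5.15) for the Izergin–Korepin family, without FKG.
-/

noncomputable section

namespace Summit.CriticalPhenomena.CardyFormulaZ2.Theorems.IKLinearTransport.PinnedDiagramExchange

open scoped Classical MeasureTheory ENNReal symmDiff
open Set MeasureTheory
open Literature.Probability.Percolation Literature.Probability.LatticeModels

/-- The factorisation identity holds for every admissible pattern. [folklore] -/
theorem tc_factorisation (i : ℤ) (T : Set ℤ) (hT : i ∈ T ↔ i + 1 ∉ T) : TcFactorisation i T :=
  tc_factorisation_of i T (stub_TwoCutGauge i T hT (stub_TwoCutComb i)) stub_RectIdentity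

/-- STUB `stub_TwoSidedCutMarkovKernel` (K₂) of the line `pinned-diagram-exchange` (crux stmt-CriticalPhenomena-5076):
for admissible `(S, i)` there is a cut-Markov version of the conditional law of the middle row `0` of
`νmix (S ∆ {i,i+1})` given the row statistic which is ALSO two-sided environment-local (`ReadsEnv`) — the canonical
atom version `tcK`. [folklore] -/
theorem stub_TwoSidedCutMarkovKernel : ∀ (S : Set ℤ) (i : ℤ), (i ∈ S ↔ i + 1 ∉ S) → StripDiagramExchange S i → ∃ k : (Obs × Set (Site 2 × Site 2)) × Obs → Bool × Bool × Bool → ℝ, CutMarkovKernel S i k ∧ ReadsEnv i k := by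
  intro S i hS _
  have hT : i ∈ S ∆ {i, i + 1} ↔ i + 1 ∉ S ∆ {i, i + 1} := by
    simp only [mem_symmDiff, mem_insert_iff, mem_singleton_iff]
    constructor <;> intro h1 <;> [skip; skip] <;> (first | omega | tauto)
  exact ⟨tcK i (S ∆ {i, i + 1}), tc_cutMarkovKernel_of i S hS (tc_factorisation i _ hT)⟩

end Summit.CriticalPhenomena.CardyFormulaZ2.Theorems.IKLinearTransport.PinnedDiagramExchange
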